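import Summits.BirchSwinnertonDyer.BirchSwinnertonDyer.Theorems.CMKolyvaginAtInertTwoRationalDescentAtTwoHabitat
import Summits.BirchSwinnertonDyer.BirchSwinnertonDyer.Theorems.CMKolyvaginAtInertTwoRationalDescentAtTwoInfRes
import HarnessLib

/-!
# Route `CMKolyvaginAtInertTwo`, crux `CMKolyvaginExactAtInertTwo` (stmt-BirchSwinnertonDyer-24277):
# THE OVER-`ℚ` BIT, ASSEMBLED — `y_K ∉ 2E(K)` ⟹ `Sel₂(E/K) ⊆ {0, δ₂ y_K}` on H₂ modulo the two
# Poitou–Tate binders (dual), (lag) and the LOCAL descent binder (desc-loc) only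

Seat `bsd-line-cmk2-p1` g8 (cell `bsd-print-cf2`); helper (`--supports stmt-BirchSwinnertonDyer-24277`);
fourth file of the over-`ℚ` bit: `…RationalDescentAtTwoHabitat.selmer_two_eq_zero_or_eq_kummer_of_cmInert_families`
(p628469) with its binder (inj) and the `H¹`-half of (desc) DISCHARGED by `…RationalDescentAtTwoInfRes`
(`resTorsion_two_injective`, `exists_resTorsion_two_eq_of_conjAct_eq`: inflation–restriction at level `2`,
`E(K)[2] = 0` from `ρ̄_{E,2}` onto). THEOREMS ONLY; no item is closed; BSD is not proved by this.

* `selmer_two_eq_zero_or_eq_kummer_of_cmInert_rat` — ON H₂ (`HasCM`, `CMInert W 2`, `ρ̄₂` onto, `K`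
  imaginary quadratic Heegner for `N_E`, `c ≠ 1`, `P = y_K` Heegner of level `N_E`, `P ∉ 2E(K)`, ty2's
  CM-inert-supported data `D`, `R`): every class of `Sel₂(E/K)` is `0` or `δ₂ y_K`, GIVEN ONLY
  (desc-loc) a class `ξ ∈ H¹(ℚ, E[2])` whose restriction lies in `Sel₂(E/K)` satisfies the Selmer
  condition over `ℚ` at every finite place `≠ u` and at `∞` [true for `u = (q)`, `d_K = −q`: split
  places `K_w = ℚ_v`; unramified good places incl. `2`: `H¹(K_w/ℚ_v, E(K_w)) = 0`, Milne ADT I.3.8;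
  `∞`: `H¹(ℝ, E[2]) = 0` as `Δ_E < 0`], (dual) Poitou–Tate over `ℚ` with local duality at a Kolyvagin
  `ℓ` [Milne ADT I Thm. 4.10, Cor. 2.3, Thm. 2.6: `∑_v inv_v(ξ_v ∪ κ_v) = inv_ℓ(ξ_ℓ ∪ κ_ℓ)` for `ξ`
  strict at `u` and the descended Kolyvagin class `κ`; `H¹_ur(ℚ_ℓ, E[2]) ≅ ℤ/2` self-annihilating], and
  (lag) the one-place count at `u` with `#E(ℚ_u)[2] = 2` [`#S^♯ = #Φ_u · #S_♭`]. So: `E(K)/2E(K) = ⟨y_K⟩`,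
  `Ш(E/K)[2] = 0`, `#Ш(E/K)[2^∞] = 1 = 4^{M₀}` — the `M₀ = 0` case of the crux for `K = ℚ(√−q)` with
  `Frob_q` a transposition on `E[2]`, modulo (desc-loc), (dual), (lag) and the `p = 2` Kolyvagin data.

References: [GrossLMS1991] §§5–6, §10; [McCallumLMS1991] §2 Prop. 2.2, §3, §5 Lemma 5.3;
[MilneADT2006] I Cor. 2.3, Thm. 2.6, Prop. 3.8, Thm. 4.10; [Kolyvagin1989Izv] §3.
-/

-- single-conjunct summit: `Summit.BirchSwinnertonDyer.BirchSwinnertonDyer.…` repeats the name by design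
set_option linter.dupNamespace false
set_option autoImplicit false

noncomputable section

open scoped Classical
open WeierstrassCurve NumberField IsDedekindDomain Field
open Literature.NumberTheory.GaloisRepresentations Literature.NumberTheory.EllipticCurves

namespace Summit.BirchSwinnertonDyer.BirchSwinnertonDyer.Theorems.KolyvaginRatDescentTwo

variable (W : WeierstrassCurve ℚ) {K : Type} [Field K] [NumberField K]

/-- **ON H₂: `y_K ∉ 2E(K)` ⟹ `Sel₂(E/K) ⊆ {0, δ₂ y_K}` modulo (desc-loc), (dual), (lag)** — see the
module docstring for the setting and the truth of the three binders. The inputs `Δ_E < 0`, `Δ_E ∉ K²`,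
the point system at `(2, 1)`, `τ = 1` on `Sel₂(E/K)` (g6), Gross 6.2 (2), the Čebotarev leaf at `2`
(g3), `res` injective and the descent of `τ`-invariant classes (this seat) are all discharged in the
kernel. [cite: GrossLMS1991, Prop. 2.1 with §10, Props. 5.4, 6.2] [cite: McCallumLMS1991, §2
Prop. 2.2, §3 Cor. 3.2, §5 Lemma 5.3] [cite: MilneADT2006, Ch. I, Thm. 4.10] [cite: Kolyvagin1989Izv, §3] -/
theorem selmer_two_eq_zero_or_eq_kummer_of_cmInert_rat [W.IsElliptic] [W.IsGloballyMinimal]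
    [NeZero (W.conductorNorm ℤ)] (hCM : W.HasCM)
    (hin : Literature.NumberTheory.EllipticCurves.Rank1Residual.CMInert W 2)
    (hsurj : W.HasSurjectiveModNGaloisRep 2) (hK : IsImaginaryQuadratic K)
    (hH : SatisfiesHeegnerHypothesis (W.conductorNorm ℤ) K)
    {P : (W.baseChange K).toAffine.Point} (hP : IsHeegnerPoint (W.conductorNorm ℤ) W K P)
    {c : K ≃ₐ[ℚ] K} (hc : c ≠ 1) (hy : ∀ Q : (W.baseChange K).toAffine.Point, 2 • Q ≠ P)
    (D : Rank1Residual.P2.KolyvaginMachine.PointSystemFamily (W.conductorNorm ℤ) W K P 2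
      (Literature.NumberTheory.EllipticCurves.Rank1Residual.CMInert W))
    (R : Rank1Residual.P2.KolyvaginMachine.ReciprocityFamily (W.conductorNorm ℤ) W K 2
      (Literature.NumberTheory.EllipticCurves.Rank1Residual.CMInert W))
    (hdiv : ∀ Q : geomPoints (W.baseChange K), ∃ R, ((2 ^ 1 : ℕ) : ℤ) • R = Q)
    (u : HeightOneSpectrum (𝓞 ℚ))
    (hdescloc : ∀ s ∈ selmerGroup (W.baseChange K) ((2 ^ 1 : ℕ) : ℤ),
      ∀ ξ : galH1Torsion W ((2 ^ 1 : ℕ) : ℤ), resTorsion W K ((2 ^ 1 : ℕ) : ℤ) ξ = s →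
        (∀ v : HeightOneSpectrum (𝓞 ℚ), v ≠ u →
            ξ ∈ selmerLocalKer W (v.adicCompletion ℚ) ((2 ^ 1 : ℕ) : ℤ)) ∧
          ∀ w : InfinitePlace ℚ, ξ ∈ selmerLocalKer W w.Completion ((2 ^ 1 : ℕ) : ℤ))
    (hdual : ∀ {ℓ : ℕ} (hℓ : IsKolyvaginPrime (W.conductorNorm ℤ) W K 2 ℓ),
      FrobEqFrobInfty W K (2 ^ 1) ℓ →
      ∀ d : galH1Torsion (W.baseChange K) ((2 ^ 1 : ℕ) : ℤ), conjAct W c ((2 ^ 1 : ℕ) : ℤ) d = d →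
      (∀ v : HeightOneSpectrum (𝓞 K), (ℓ : 𝓞 K) ∉ v.asIdeal →
        d ∈ selmerLocalKer (W.baseChange K) (v.adicCompletion K) ((2 ^ 1 : ℕ) : ℤ)) →
      (∀ w : InfinitePlace K, d ∈ selmerLocalKer (W.baseChange K) w.Completion ((2 ^ 1 : ℕ) : ℤ)) →
      d ∉ selmerLocalKer (W.baseChange K) (hℓ.place.adicCompletion K) ((2 ^ 1 : ℕ) : ℤ) →
      ∀ ξ : galH1Torsion W ((2 ^ 1 : ℕ) : ℤ),
      ((∀ v : HeightOneSpectrum (𝓞 ℚ), v ≠ u →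
          ξ ∈ selmerLocalKer W (v.adicCompletion ℚ) ((2 ^ 1 : ℕ) : ℤ)) ∧
          ∀ w : InfinitePlace ℚ, ξ ∈ selmerLocalKer W w.Completion ((2 ^ 1 : ℕ) : ℤ)) →
      ξ ∈ W.torsionLocalKer (u.adicCompletion ℚ) ((2 ^ 1 : ℕ) : ℤ) →
      resTorsion W K ((2 ^ 1 : ℕ) : ℤ) ξ ∈
        (W.baseChange K).torsionLocalKer (hℓ.place.adicCompletion K) ((2 ^ 1 : ℕ) : ℤ))
    (hlag : ∀ ξ₁ ξ₂ : galH1Torsion W ((2 ^ 1 : ℕ) : ℤ),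
      ((∀ v : HeightOneSpectrum (𝓞 ℚ), v ≠ u →
          ξ₁ ∈ selmerLocalKer W (v.adicCompletion ℚ) ((2 ^ 1 : ℕ) : ℤ)) ∧
          ∀ w : InfinitePlace ℚ, ξ₁ ∈ selmerLocalKer W w.Completion ((2 ^ 1 : ℕ) : ℤ)) →
      ((∀ v : HeightOneSpectrum (𝓞 ℚ), v ≠ u →
          ξ₂ ∈ selmerLocalKer W (v.adicCompletion ℚ) ((2 ^ 1 : ℕ) : ℤ)) ∧
          ∀ w : InfinitePlace ℚ, ξ₂ ∈ selmerLocalKer W w.Completion ((2 ^ 1 : ℕ) : ℤ)) →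
      ξ₁ ∉ W.torsionLocalKer (u.adicCompletion ℚ) ((2 ^ 1 : ℕ) : ℤ) →
      ξ₂ ∉ W.torsionLocalKer (u.adicCompletion ℚ) ((2 ^ 1 : ℕ) : ℤ) →
      ξ₁ - ξ₂ ∈ W.torsionLocalKer (u.adicCompletion ℚ) ((2 ^ 1 : ℕ) : ℤ)) :
    ∀ s ∈ selmerGroup (W.baseChange K) ((2 ^ 1 : ℕ) : ℤ),
      s = 0 ∨ s = kummerMapTorsion (W.baseChange K) ((2 ^ 1 : ℕ) : ℤ) hdiv P := by
  -- (inj) and the `H¹`-half of (desc), discharged (inflation–restriction at level `2`, `E(K)[2] = 0`)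
  have hinj : Function.Injective (resTorsion W K ((2 ^ 1 : ℕ) : ℤ)) :=
    resTorsion_two_injective K W hsurj hK hc
  have hdesc : ∀ s ∈ selmerGroup (W.baseChange K) ((2 ^ 1 : ℕ) : ℤ),
      conjAct W c ((2 ^ 1 : ℕ) : ℤ) s = s → ∃ ξ : galH1Torsion W ((2 ^ 1 : ℕ) : ℤ),
        ((∀ v : HeightOneSpectrum (𝓞 ℚ), v ≠ u →
            ξ ∈ selmerLocalKer W (v.adicCompletion ℚ) ((2 ^ 1 : ℕ) : ℤ)) ∧
          ∀ w : InfinitePlace ℚ, ξ ∈ selmerLocalKer W w.Completion ((2 ^ 1 : ℕ) : ℤ)) ∧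
        resTorsion W K ((2 ^ 1 : ℕ) : ℤ) ξ = s := by
    intro s hs hτs
    obtain ⟨ξ, hξ⟩ : ∃ ξ : galH1Torsion W ((2 ^ 1 : ℕ) : ℤ), resTorsion W K ((2 ^ 1 : ℕ) : ℤ) ξ = s :=
      exists_resTorsion_two_eq_of_conjAct_eq K W hsurj hK hc hτs
    exact ⟨ξ, hdescloc s hs ξ hξ, hξ⟩
  exact selmer_two_eq_zero_or_eq_kummer_of_cmInert_families W hCM hin hsurj hK hH hP hc hy D R hdiv hinj
    u hdesc hdual hlag

end Summit.BirchSwinnertonDyer.BirchSwinnertonDyer.Theorems.KolyvaginRatDescentTwo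

end
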